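import Summits.SmoothPoincare4.SmoothPoincare4.Theorems.HeegaardHandlebodyCongruenceClosed.Negative.Gate
import Summits.SmoothPoincare4.SmoothPoincare4.Theorems.ShadowApproximation.Negative.UnitTwist

/-!
# `HeegaardHandlebodyCongruenceClosed` — negative-side support (2/5): explicit automorphisms of `S₃`

Genus-3 (`m = 0`) witnesses as honest `MulEquiv`s of the presented surface group
`S₃ = ⟨a₀,b₀,a₁,b₁,a₂,b₂ ∣ ∏[aᵢ,bᵢ]⟩`: `ρ₀` (quarter rotation of handle 0), `θ` (Dehn twist about the
`(1,1)`-curve of handle 1) and `ρ₁ = θ²`; built with the genus-3 toolkit (`liftHom`, `rel_three`, …) already landed in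
`Theorems/ShadowApproximation/Negative/UnitTwist.lean`, which this file imports and reuses.
Every identity is a free-group identity verified by `group`. See `Negative/Gate.lean` (1/5) for the
statement being attacked and the module docstring there for the overall findings. [folklore]
-/

namespace Summit.SmoothPoincare4.SmoothPoincare4.Theorems.HeegaardHandlebodyCongruenceClosed.Negative

open Literature.Topology.FourManifolds Subgroup

section GenusThree

open SurfaceGroup
open Summit.SmoothPoincare4.SmoothPoincare4.Theorems.ShadowApproximation.Negative
  (surfaceRelator_three of_eq_a of_eq_b rel_three lift_surfaceRelator_three liftHom liftHom_of
    liftHom_a liftHom_b)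

/-! ## Genus 3 (`m = 0`): explicit automorphisms and non-gate certificates -/

/-! The genus-3 toolkit (`surfaceRelator_three`, `of_eq_a`/`of_eq_b`, `rel_three`,
`lift_surfaceRelator_three`, `liftHom`, `liftHom_of/_a/_b`) is the one already landed in
`Theorems/ShadowApproximation/Negative/UnitTwist.lean` (and `ShadowsOnlyFalse.lean`), opened above. -/

/-! ### `ρ₀`: the quarter-rotation of handle 0 (`a₀ ↦ a₀b₀a₀⁻¹`, `b₀ ↦ a₀⁻¹`) -/

/-- generator images of `ρ₀` [folklore] -/
def rho0Fun (p : surfaceGen 3) : SurfaceGroup 3 :=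
  if p.1 = 0 then (if p.2 then (a 0)⁻¹ else a 0 * b 0 * (a 0)⁻¹) else PresentedGroup.of p

/-- generator images of `ρ₀⁻¹` (`a₀ ↦ b₀⁻¹`, `b₀ ↦ b₀a₀b₀⁻¹`) [folklore] -/
def rho0InvFun (p : surfaceGen 3) : SurfaceGroup 3 :=
  if p.1 = 0 then (if p.2 then b 0 * a 0 * (b 0)⁻¹ else (b 0)⁻¹) else PresentedGroup.of p

/-- helper lemma `rho0Fun_rel` (see the module docstring). [folklore] -/
theorem rho0Fun_rel : FreeGroup.lift rho0Fun (surfaceRelator 3) = 1 := by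
  rw [lift_surfaceRelator_three, ← rel_three]
  simp [rho0Fun, of_eq_a, of_eq_b]
  group

/-- helper lemma `rho0InvFun_rel` (see the module docstring). [folklore] -/
theorem rho0InvFun_rel : FreeGroup.lift rho0InvFun (surfaceRelator 3) = 1 := by
  rw [lift_surfaceRelator_three, ← rel_three]
  simp [rho0InvFun, of_eq_a, of_eq_b]
  group

/-- `ρ₀` as a hom [folklore] -/
def rho0Hom : SurfaceGroup 3 →* SurfaceGroup 3 := liftHom rho0Fun rho0Fun_rel
/-- `ρ₀⁻¹` as a hom [folklore] -/
def rho0InvHom : SurfaceGroup 3 →* SurfaceGroup 3 := liftHom rho0InvFun rho0InvFun_rel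

/-- helper lemma `rho0Inv_comp` (see the module docstring). [folklore] -/
theorem rho0Inv_comp : rho0InvHom.comp rho0Hom = MonoidHom.id _ := by
  apply PresentedGroup.ext
  rintro ⟨i, _ | _⟩ <;> fin_cases i <;>
    simp [rho0Hom, rho0InvHom, rho0Fun, rho0InvFun, of_eq_a, of_eq_b]
  all_goals group

/-- helper lemma `rho0_comp_inv` (see the module docstring). [folklore] -/
theorem rho0_comp_inv : rho0Hom.comp rho0InvHom = MonoidHom.id _ := by
  apply PresentedGroup.ext
  rintro ⟨i, _ | _⟩ <;> fin_cases i <;>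
    simp [rho0Hom, rho0InvHom, rho0Fun, rho0InvFun, of_eq_a, of_eq_b]
  all_goals group

/-- **`ρ₀ ∈ Aut S₃`**: the automorphism induced by the quarter rotation of the first handle
(`a₀ ↦ a₀b₀a₀⁻¹`, `b₀ ↦ a₀⁻¹`, other generators fixed; it fixes `[a₀,b₀]` on the nose). [folklore] -/
def rho0 : SurfaceGroup 3 ≃* SurfaceGroup 3 := MonoidHom.toMulEquiv rho0Hom rho0InvHom rho0Inv_comp rho0_comp_inv

/-- helper lemma `rho0_a0` (see the module docstring). [folklore] -/
@[simp] theorem rho0_a0 : rho0 (a 0) = a 0 * b 0 * (a 0)⁻¹ := by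
  simp [rho0, rho0Hom, rho0Fun]
/-- helper lemma `rho0_b0` (see the module docstring). [folklore] -/
@[simp] theorem rho0_b0 : rho0 (b 0) = (a 0)⁻¹ := by
  simp [rho0, rho0Hom, rho0Fun]
/-- helper lemma `rho0_a1` (see the module docstring). [folklore] -/
@[simp] theorem rho0_a1 : rho0 (a 1) = a 1 := by
  simp [rho0, rho0Hom, rho0Fun, of_eq_a]
/-- helper lemma `rho0_a2` (see the module docstring). [folklore] -/
@[simp] theorem rho0_a2 : rho0 (a 2) = a 2 := by
  simp [rho0, rho0Hom, rho0Fun, of_eq_a]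
/-- helper lemma `rho0_b1` (see the module docstring). [folklore] -/
@[simp] theorem rho0_b1 : rho0 (b 1) = b 1 := by
  simp [rho0, rho0Hom, rho0Fun, of_eq_b]
/-- helper lemma `rho0_b2` (see the module docstring). [folklore] -/
@[simp] theorem rho0_b2 : rho0 (b 2) = b 2 := by
  simp [rho0, rho0Hom, rho0Fun, of_eq_b]

/-! ### `θ`: the Dehn twist about the `(1,1)`-curve of handle 1 (`a₁ ↦ a₁b₁a₁`, `b₁ ↦ a₁⁻¹`) -/

/-- generator images of `θ` [folklore] -/
def thetaFun (p : surfaceGen 3) : SurfaceGroup 3 :=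
  if p.1 = 1 then (if p.2 then (a 1)⁻¹ else a 1 * b 1 * a 1) else PresentedGroup.of p

/-- generator images of `θ⁻¹` (`a₁ ↦ b₁⁻¹`, `b₁ ↦ b₁a₁b₁`) [folklore] -/
def thetaInvFun (p : surfaceGen 3) : SurfaceGroup 3 :=
  if p.1 = 1 then (if p.2 then b 1 * a 1 * b 1 else (b 1)⁻¹) else PresentedGroup.of p

/-- helper lemma `thetaFun_rel` (see the module docstring). [folklore] -/
theorem thetaFun_rel : FreeGroup.lift thetaFun (surfaceRelator 3) = 1 := by
  rw [lift_surfaceRelator_three, ← rel_three]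
  simp [thetaFun, of_eq_a, of_eq_b]
  group

/-- helper lemma `thetaInvFun_rel` (see the module docstring). [folklore] -/
theorem thetaInvFun_rel : FreeGroup.lift thetaInvFun (surfaceRelator 3) = 1 := by
  rw [lift_surfaceRelator_three, ← rel_three]
  simp [thetaInvFun, of_eq_a, of_eq_b]
  group

/-- `θ` as a hom [folklore] -/
def thetaHom : SurfaceGroup 3 →* SurfaceGroup 3 := liftHom thetaFun thetaFun_rel
/-- `θ⁻¹` as a hom [folklore] -/
def thetaInvHom : SurfaceGroup 3 →* SurfaceGroup 3 := liftHom thetaInvFun thetaInvFun_rel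

/-- helper lemma `thetaInv_comp` (see the module docstring). [folklore] -/
theorem thetaInv_comp : thetaInvHom.comp thetaHom = MonoidHom.id _ := by
  apply PresentedGroup.ext
  rintro ⟨i, _ | _⟩ <;> fin_cases i <;>
    simp [thetaHom, thetaInvHom, thetaFun, thetaInvFun, of_eq_a, of_eq_b]
  all_goals group

/-- helper lemma `theta_comp_inv` (see the module docstring). [folklore] -/
theorem theta_comp_inv : thetaHom.comp thetaInvHom = MonoidHom.id _ := by
  apply PresentedGroup.ext
  rintro ⟨i, _ | _⟩ <;> fin_cases i <;>
    simp [thetaHom, thetaInvHom, thetaFun, thetaInvFun, of_eq_a, of_eq_b]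
  all_goals group

/-- **`θ ∈ Aut S₃`**: the Dehn twist about the simple closed curve of slope `(1,1)` on the second
handle (`a₁ ↦ a₁b₁a₁`, `b₁ ↦ a₁⁻¹`; fixes `[a₁,b₁]` on the nose; acts on `H₁` by `a₁ ↦ 2a₁+b₁`,
`b₁ ↦ -a₁`, the symplectic transvection along `a₁+b₁`). [folklore] -/
def theta : SurfaceGroup 3 ≃* SurfaceGroup 3 :=
  MonoidHom.toMulEquiv thetaHom thetaInvHom thetaInv_comp theta_comp_inv

/-- helper lemma `theta_a1` (see the module docstring). [folklore] -/
@[simp] theorem theta_a1 : theta (a 1) = a 1 * b 1 * a 1 := by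
  simp [theta, thetaHom, thetaFun]
/-- helper lemma `theta_b1` (see the module docstring). [folklore] -/
@[simp] theorem theta_b1 : theta (b 1) = (a 1)⁻¹ := by
  simp [theta, thetaHom, thetaFun]
/-- helper lemma `theta_a0` (see the module docstring). [folklore] -/
@[simp] theorem theta_a0 : theta (a 0) = a 0 := by
  simp [theta, thetaHom, thetaFun, of_eq_a]
/-- helper lemma `theta_a2` (see the module docstring). [folklore] -/
@[simp] theorem theta_a2 : theta (a 2) = a 2 := by
  simp [theta, thetaHom, thetaFun, of_eq_a]
/-- helper lemma `theta_b0` (see the module docstring). [folklore] -/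
@[simp] theorem theta_b0 : theta (b 0) = b 0 := by
  simp [theta, thetaHom, thetaFun, of_eq_b]
/-- helper lemma `theta_b2` (see the module docstring). [folklore] -/
@[simp] theorem theta_b2 : theta (b 2) = b 2 := by
  simp [theta, thetaHom, thetaFun, of_eq_b]

/-- **`ρ₁ = θ²`**, the square of the `(1,1)`-twist: trivial on `H₁(S₃; 𝔽₂)`. [folklore] -/
def rho1 : SurfaceGroup 3 ≃* SurfaceGroup 3 := theta.trans theta

/-- helper lemma `rho1_a1` (see the module docstring). [folklore] -/
@[simp] theorem rho1_a1 : rho1 (a 1) = a 1 * b 1 * a 1 * b 1 * a 1 := by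
  simp [rho1]; group
/-- helper lemma `rho1_b1` (see the module docstring). [folklore] -/
@[simp] theorem rho1_b1 : rho1 (b 1) = (a 1)⁻¹ * (b 1)⁻¹ * (a 1)⁻¹ := by
  simp [rho1]; group
/-- helper lemma `rho1_a0` (see the module docstring). [folklore] -/
@[simp] theorem rho1_a0 : rho1 (a 0) = a 0 := by simp [rho1]
/-- helper lemma `rho1_a2` (see the module docstring). [folklore] -/
@[simp] theorem rho1_a2 : rho1 (a 2) = a 2 := by simp [rho1]
/-- helper lemma `rho1_b0` (see the module docstring). [folklore] -/
@[simp] theorem rho1_b0 : rho1 (b 0) = b 0 := by simp [rho1]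
/-- helper lemma `rho1_b2` (see the module docstring). [folklore] -/
@[simp] theorem rho1_b2 : rho1 (b 2) = b 2 := by simp [rho1]

end GenusThree

end Summit.SmoothPoincare4.SmoothPoincare4.Theorems.HeegaardHandlebodyCongruenceClosed.Negative
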